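import Literature.NumberTheory.EllipticCurves.DivisionValuesRootsOfUnity
import Literature.NumberTheory.EllipticCurves.SelmerCorankProofs
import Literature.NumberTheory.EllipticCurves.TorsionCardinality
import Summits.BirchSwinnertonDyer.Rank1Residual.GaloisImage.KolyvaginScalarTransport
import Summits.BirchSwinnertonDyer.Rank1Residual.GaloisImage.PadicTwistClassDecider
import Summits.BirchSwinnertonDyer.Rank1Residual.GaloisImage.VisibleWitnessHybridPlaces
import Mathlib.FieldTheory.Galois.Infinite
import HarnessLib

/-!
# `#E(K)[3] ≤ 3` when `μ₃(K) = 1` (Weil pairing), and the decidable local instance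
# `#E(ℚ_v)[3] ≤ 3` at every place `v` with `sqFlagAt q (−3) w₃ = false`
# (team n1011, row T-DIV3L, FILE D14)

HONEST FRAMING (cell `b2b-bsdres`, run/shared/lean/b2b/bsd-rank1-residual/, verbatim in every
file): the goal of the cell is to DELETE the COMBINATION-SHAPED residual classes of the
Birch–Swinnerton-Dyer formula for ALL analytic-rank `≤ 1` elliptic curves over `ℚ` — "full BSD
formula for every rank `≤ 1` curve in class `C`" assembled STRICTLY from published theorems — so
that the rank-`≤ 1` remainder becomes exactly the CONSTRUCTION-SHAPED classes, which are TYPED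
(missing-input `Prop`s), NOT attempted. This is not "finishing BSD". Team n1011 (N10/N11): research
route; this file is a TOOL; nothing is booked by it; no mark / label moved; X4 stays
CONSTRUCTION-SHAPED. THEOREMS only; no definition, no named fact of ours, no `sorry`.

## What

The local count binders of the visibility roads ask `#E′(ℚ_v)[3]` — `= 1` at free places (T-LOC3T
certificates), `≤ 3` at a costly place (FILE D13's `ht`, kind (ii)'s `hcard`). The T-LOC3T deciders
need `v ∤ 3`; at the place `3` itself (r1's 11 PASS-rank3 rows with `#E′(ℚ₃)[3] = 3`) no certificate
existed. This file proves the UNIVERSAL bound instead: for an elliptic curve `E` over a field `K`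
of characteristic `0` with NO primitive cube root of unity, `#E(K)[3] ≤ 3` — if all nine geometric
`3`-torsion points were `K`-rational, the Weil pairing would put `μ₃` into `K` (Silverman AEC
III.8.1.1, tree `exists_isPrimitiveRoot_fixed`; Galois descent by Mathlib's infinite Galois theory).
The decidable instance: at the place `v` of a prime `q` with `sqFlagAt q (−3) w₃ = false`
(`q = 3` or `q ≡ 2 mod 3`; T-LOC3L FILE L6 `forall_pow_three_eq_one_adicCompletion_of_sqFlagAt`),
`#E(ℚ_v)[3] ≤ 3` for EVERY `E/ℚ` — no per-curve certificate at all.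

ENDs: `natCard_torsionBy_three_le_three_of_forall_pow_three_eq_one` (any char-0 field),
`relIndex_eq_one_of_kindII_checks_of_intModel_of_sqFlagAt` (APPENDED: D9's kind (ii) with this
bound instead of a T-LOC3T certificate),
`natCard_ker_nsmul_three_adicCompletion_le_three_of_sqFlagAt` (records currency
`Nat.card (nsmulAddMonoidHom 3 : E(ℚ_v) →+ E(ℚ_v)).ker ≤ 3`), and the instance at `v = 3`.

References: [SilvermanAEC2009] III.6.4(b), III.8.1.1, VIII.1; [Serre1973] II.3.3.
-/

set_option autoImplicit false

noncomputable section

open scoped Classical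

open WeierstrassCurve NumberField IsDedekindDomain Rat.HeightOneSpectrum Field
  Literature.NumberTheory.EllipticCurves Literature.NumberTheory.GaloisRepresentations
open Summit.BirchSwinnertonDyer.Rank1Residual.GaloisImage.LocalTorsion3At
  (sqFlagAt forall_pow_three_eq_one_adicCompletion_of_sqFlagAt)

namespace Summit.BirchSwinnertonDyer.Rank1Residual.GaloisImage.DivisionDecider

section General

variable {K : Type} [Field K] [CharZero K] (W : WeierstrassCurve K) [W.IsElliptic]

/-- **`#E(K)[3] ≤ 3` when `μ₃(K) = 1`.** For an elliptic curve `E` over a field `K` of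
characteristic `0` in which every cube root of unity is `1`, the `K`-rational `3`-torsion has at
most `3` points: otherwise it has `9` (a `3`-group inside `E(K̄)[3]`, which has `9`), so every
geometric `3`-torsion point is `K`-rational, hence fixed by `Γ_K`, and the Weil pairing yields a
primitive cube root of unity fixed by `Γ_K` (Silverman III.8.1.1), i.e. in `K` — contradiction.
[cite: SilvermanAEC2009, Cor. III.6.4(b) and Cor. III.8.1.1] -/
theorem natCard_torsionBy_three_le_three_of_forall_pow_three_eq_one
    (hμ : ∀ ζ : K, ζ ^ 3 = 1 → ζ = 1) :
    Nat.card (AddSubgroup.torsionBy W.toAffine.Point ((3 : ℕ) : ℤ)) ≤ 3 := by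
  haveI : Fact (Nat.Prime 3) := ⟨Nat.prime_three⟩
  set L := AlgebraicClosure K with hL
  set T := AddSubgroup.torsionBy W.toAffine.Point ((3 : ℕ) : ℤ) with hT
  -- the geometric 3-torsion has nine points
  haveI : (W.baseChange L).IsElliptic := inferInstanceAs (W.map (algebraMap K L)).IsElliptic
  have hG : Nat.card (geomTorsion W ((3 : ℕ) : ℤ)) = 9 := by
    have h := card_torsionBy_eq_sq (E := W.baseChange L) (n := 3) (by norm_num)
    exact h
  haveI : Finite (geomTorsion W ((3 : ℕ) : ℤ)) := Nat.finite_of_card_ne_zero (by rw [hG]; norm_num)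
  -- `E(K)[3] ↪ E(K̄)[3]`
  have hmem : ∀ P : T, toGeomPoints W (P : W.toAffine.Point) ∈ geomTorsion W ((3 : ℕ) : ℤ) := by
    intro P
    have hP : ((3 : ℕ) : ℤ) • (P : W.toAffine.Point) = 0 := P.2
    show ((3 : ℕ) : ℤ) • toGeomPoints W (P : W.toAffine.Point) = 0
    rw [← map_zsmul, hP, map_zero]
  let ι : T → geomTorsion W ((3 : ℕ) : ℤ) := fun P => ⟨toGeomPoints W P, hmem P⟩
  have hι : Function.Injective ι := fun P Q hPQ =>
    Subtype.ext (toGeomPoints_injective W (congrArg Subtype.val hPQ))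
  haveI : Finite T := Finite.of_injective ι hι
  by_contra hlt
  rw [not_le] at hlt
  -- `#E(K)[3]` is a power of `3`, at most `9`, more than `3`: it is `9`
  obtain ⟨a, ha⟩ := Transport.exists_natCard_eq_pow_of_nsmul_eq_zero (p := 3) (K := 1) (X := T)
    (fun x => by rw [pow_one]; exact AddSubgroup.torsionBy.nsmul x)
  have hle9 : Nat.card T ≤ 9 := hG ▸ Nat.card_le_card_of_injective ι hι
  have ha2 : a = 2 := by
    rw [ha] at hlt hle9
    have h1 : 1 < a := by
      by_contra h; rw [not_lt] at h
      exact absurd (Nat.pow_le_pow_right (by norm_num : 0 < 3) h) (by simpa using hlt)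
    have h2 : a ≤ 2 := by
      by_contra h; rw [not_le] at h
      have : 3 ^ 3 ≤ 3 ^ a := Nat.pow_le_pow_right (by norm_num) h
      omega
    omega
  have hcard : Nat.card T = 9 := by rw [ha, ha2]; norm_num
  -- so `ι` is a bijection: every geometric 3-torsion point is `K`-rational, hence `Γ_K`-fixed
  have hbij : Function.Bijective ι := hι.bijective_of_nat_card_le (by rw [hG, hcard])
  have hfixT : ∀ (τ : Field.absoluteGaloisGroup K) (Q : geomTorsion W ((3 : ℕ) : ℤ)), τ • Q = Q := by
    intro τ Q
    obtain ⟨P, rfl⟩ := hbij.2 Q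
    apply Subtype.ext
    rw [AddSubgroup.torsionBy.coe_smul]
    exact smul_toGeomPoints W τ P
  -- a geometric point of exact order 3
  have hnt : Nontrivial (geomTorsion W ((3 : ℕ) : ℤ)) := by
    rw [← Finite.one_lt_card_iff_nontrivial, hG]; norm_num
  obtain ⟨Q₀, hQ₀⟩ := exists_ne (0 : geomTorsion W ((3 : ℕ) : ℤ))
  have hT₀ : ∃ T₀ : W.geomPoints, ((3 : ℕ) : ℤ) • T₀ = 0 ∧
      ∀ d : ℕ, 0 < d → d < 3 → (d : ℤ) • T₀ ≠ 0 := by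
    refine ⟨Q₀, Q₀.2, fun d hd hd3 h => hQ₀ (Subtype.ext ?_)⟩
    have h3 : ((3 : ℕ) : ℤ) • (Q₀ : W.geomPoints) = 0 := Q₀.2
    interval_cases d
    · simpa using h
    · -- `2 • Q₀ = 0` and `3 • Q₀ = 0` give `Q₀ = 0`
      have e : (Q₀ : W.geomPoints) = ((3 : ℕ) : ℤ) • (Q₀ : W.geomPoints) - (2 : ℤ) • Q₀ := by
        module
      rw [e, h3, zero_sub, show ((2 : ℕ) : ℤ) = 2 from rfl] at *
      simpa using congrArg Neg.neg h
  obtain ⟨ζ, hζ, hfix⟩ := exists_isPrimitiveRoot_fixed (E := W) (q := 3) (by norm_num) hT₀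
  have hfixζ : ∀ τ : Field.absoluteGaloisGroup K, τ • ζ = ζ := fun τ => hfix τ (hfixT τ)
  -- Galois descent: `ζ ∈ K`
  haveI : PerfectField K := PerfectField.ofCharZero
  haveI : IsGalois K L := {}
  have hbot : ζ ∈ (⊥ : IntermediateField K L) := by
    rw [← InfiniteGalois.fixedField_fixingSubgroup (⊥ : IntermediateField K L),
      IntermediateField.mem_fixedField_iff]
    intro τ _
    exact hfixζ τ
  rw [IntermediateField.mem_bot] at hbot
  obtain ⟨z, hz⟩ := hbot
  have hz3 : z ^ 3 = 1 := (algebraMap K L).injective (by rw [map_pow, hz, map_one, hζ.pow_eq_one])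
  exact hζ.ne_one (by norm_num) (by rw [← hz, hμ z hz3, map_one])

end General

section Local

variable (q : ℕ) [hq : Fact q.Prime]

/-- **`#E(ℚ_v)[3] ≤ 3` at every place whose completion has no primitive cube root of unity,
decided by `sqFlagAt q (−3) w₃ = false`** (`q^{w₃} ∥ −3`; true for `q = 3` and every
`q ≡ 2 mod 3`), for EVERY elliptic `E/ℚ` — the costly-place count binder `ht` of FILE D13 / the
`hcard` of kind (ii) without any per-curve certificate. (Records currency: the kernel of
multiplication by `3` on `E(ℚ_v)`.) [cite: SilvermanAEC2009, Cor. III.8.1.1] [cite: Serre1973, Ch. II §3.3] -/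
theorem natCard_ker_nsmul_three_adicCompletion_le_three_of_sqFlagAt (W : WeierstrassCurve ℚ)
    [W.IsElliptic] {v : HeightOneSpectrum (𝓞 ℚ)} (hv : (primesEquiv v : ℕ) = q)
    {w₃ : ℕ} (hw₃ : (q : ℤ) ^ w₃ ∣ (-3 : ℤ)) (hw₃' : ¬ (q : ℤ) ^ (w₃ + 1) ∣ (-3 : ℤ))
    (hflag₃ : sqFlagAt q (-3) w₃ = false) :
    Nat.card (nsmulAddMonoidHom 3 : (W.baseChange (v.adicCompletion ℚ)).toAffine.Point →+
      (W.baseChange (v.adicCompletion ℚ)).toAffine.Point).ker ≤ 3 := by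
  have hμ := forall_pow_three_eq_one_adicCompletion_of_sqFlagAt v hv hw₃ hw₃' hflag₃
  -- fix the curve over `ℚ_v` (with the `adicCompletion` algebra structure) BEFORE `CharZero ℚ_v` is
  -- in scope: afterwards `DivisionRing.toRatAlgebra` would compete for `Algebra ℚ ℚ_v`
  set W' := W.baseChange (v.adicCompletion ℚ) with hW'
  haveI : W'.IsElliptic := inferInstanceAs (W.map (algebraMap ℚ (v.adicCompletion ℚ))).IsElliptic
  have hker : (nsmulAddMonoidHom 3 : W'.toAffine.Point →+ W'.toAffine.Point).ker =
      AddSubgroup.torsionBy W'.toAffine.Point ((3 : ℕ) : ℤ) := by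
    ext P
    rw [AddMonoidHom.mem_ker, nsmulAddMonoidHom_apply]
    exact AddSubgroup.torsionBy.nsmul_iff.symm
  rw [hker]
  haveI : CharZero (v.adicCompletion ℚ) :=
    charZero_of_injective_algebraMap (algebraMap ℚ (v.adicCompletion ℚ)).injective
  exact natCard_torsionBy_three_le_three_of_forall_pow_three_eq_one W' hμ

/-- **Instance at `v = 3`**: `#E(ℚ₃)[3] ≤ 3` for every elliptic `E/ℚ` (`3¹ ∥ −3`, odd exponent ⇒
`sqFlagAt 3 (−3) 1 = false`). The costly place of r1's PASS-rank3 rows. [folklore] -/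
theorem natCard_ker_nsmul_three_adicCompletion_le_three_at3 (W : WeierstrassCurve ℚ) [W.IsElliptic]
    {v : HeightOneSpectrum (𝓞 ℚ)} (hv : (primesEquiv v : ℕ) = 3) :
    Nat.card (nsmulAddMonoidHom 3 : (W.baseChange (v.adicCompletion ℚ)).toAffine.Point →+
      (W.baseChange (v.adicCompletion ℚ)).toAffine.Point).ker ≤ 3 :=
  natCard_ker_nsmul_three_adicCompletion_le_three_of_sqFlagAt 3 (hq := ⟨Nat.prime_three⟩) W hv
    (w₃ := 1) (by decide) (by decide) (by decide +kernel)

end Local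

section KindIIOfMu

variable (q : ℕ) [hq : Fact q.Prime]

/-- **Kind (ii) with the Weil-pairing count (APPENDED 2026-08-22, same seat): `ι_v(θ) = 1` at a
place `v` of a prime `q ≠ 3` with `μ₃(ℚ_v) = 1` (`sqFlagAt q (−3) w₃ = false`, i.e. `q ≡ 2 mod 3`)
where both `3`-congruent curves are SPLIT multiplicative (root certificates)** — FILE D9's
`relIndex_eq_one_of_kindII_checks_of_intModel` with its `#E(ℚ_v)[3] ≤ 3` input supplied by
`natCard_ker_nsmul_three_adicCompletion_le_three_of_sqFlagAt` instead of a T-LOC3T certificate;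
conditional on Tate's uniformisation `hU` (displayed). [cite: SilvermanATAEC1994, Ch. V Thm. 3.1, Thm. 5.3]
[cite: SilvermanAEC2009, VII.5 Prop. 5.1(b), Cor. III.8.1.1] -/
theorem relIndex_eq_one_of_kindII_checks_of_intModel_of_sqFlagAt
    (hU : Silverman1994_thmV53_tateUniformisation.{0})
    (W W' : WeierstrassCurve ℚ) [W.IsElliptic] [W'.IsElliptic] [W.IsGloballyMinimal]
    [W'.IsGloballyMinimal] {E₀ F₀ : WeierstrassCurve ℤ} (hI : W.integralModelInt = E₀)
    (hI' : W'.integralModelInt = F₀)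
    (θ : geomTorsion W' ((3 : ℕ) : ℤ) ≃+ geomTorsion W ((3 : ℕ) : ℤ))
    (hθ : ∀ (σ : Field.absoluteGaloisGroup ℚ) (P : geomTorsion W' ((3 : ℕ) : ℤ)),
      θ (σ • P) = σ • θ P)
    {v : HeightOneSpectrum (𝓞 ℚ)} (hv : (primesEquiv v : ℕ) = q)
    (hΔ : (q : ℤ) ∣ E₀.Δ) (hc₄ : ¬ (q : ℤ) ∣ E₀.c₄) (hΔ' : (q : ℤ) ∣ F₀.Δ) (hc₄' : ¬ (q : ℤ) ∣ F₀.c₄)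
    (t t' : ZMod q)
    (ht : (E₀.c₄ : ZMod q) * t ^ 2 + ((E₀.a₁ * E₀.c₄ : ℤ) : ZMod q) * t -
      ((54 * E₀.b₆ - 3 * E₀.b₂ * E₀.b₄ + E₀.a₂ * E₀.c₄ : ℤ) : ZMod q) = 0)
    (ht' : (F₀.c₄ : ZMod q) * t' ^ 2 + ((F₀.a₁ * F₀.c₄ : ℤ) : ZMod q) * t' -
      ((54 * F₀.b₆ - 3 * F₀.b₂ * F₀.b₄ + F₀.a₂ * F₀.c₄ : ℤ) : ZMod q) = 0)
    {w₃ : ℕ} (hw₃ : (q : ℤ) ^ w₃ ∣ (-3 : ℤ)) (hw₃' : ¬ (q : ℤ) ^ (w₃ + 1) ∣ (-3 : ℤ))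
    (hflag₃ : sqFlagAt q (-3) w₃ = false) :
    haveI : Fact (Nat.Prime 3) := ⟨Nat.prime_three⟩
    (selmerLocalKer W (v.adicCompletion ℚ) ((3 : ℕ) : ℤ)).relIndex
        ((selmerLocalKer W' (v.adicCompletion ℚ) ((3 : ℕ) : ℤ)).map
          (h1Equiv θ hθ).toAddMonoidHom) = 1 := by
  haveI : Fact (Nat.Prime 3) := ⟨Nat.prime_three⟩
  have hWs := hasSplitMultiplicativeReductionAt_of_intModel_of_root q W hI hv hΔ hc₄ t ht
  have hW's := hasSplitMultiplicativeReductionAt_of_intModel_of_root q W' hI' hv hΔ' hc₄' t' ht'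
  exact W.relIndex_map_selmerLocalKer_eq_one_of_hasSplitMultiplicativeReductionAt v hU W' θ hθ hWs
    hW's (natCard_ker_nsmul_three_adicCompletion_le_three_of_sqFlagAt q W hv hw₃ hw₃' hflag₃)

end KindIIOfMu

end Summit.BirchSwinnertonDyer.Rank1Residual.GaloisImage.DivisionDecider

end
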